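import Summits.BirchSwinnertonDyer.Rank1Residual.Additive.CensusX42LeadingTerm
import Literature.NumberTheory.EllipticCurves.CanonicalPAdicHeight
import HarnessLib

/-!
# The census height of X4-2 as ONE predicate: the cyclotomic sigma height of the ADDITIVE curve
# `E` at `p` with the Mazur–Tate constant TRANSPORTED from the semistable twist `E♭`
# (item X42-m1 of `CensusX42LeadingTerm.lean`; cell `b2b-bsdres`, census cell, seat
# `b2b-bsdres-census-ctyper1`, gen 2)

HONEST FRAMING (cell `b2b-bsdres`, run/shared/lean/b2b/bsd-rank1-residual/, verbatim in every
file): the goal of the cell is to DELETE the COMBINATION-SHAPED residual classes of the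
Birch–Swinnerton-Dyer formula for ALL analytic-rank `≤ 1` elliptic curves over `ℚ` — "full BSD
formula for every rank `≤ 1` curve in class `C`" assembled STRICTLY from published theorems — so
that the rank-`≤ 1` remainder becomes exactly the CONSTRUCTION-SHAPED classes, which are TYPED
(missing-input `Prop`s), NOT attempted. This is not "finishing BSD". Census cell: research
instrumentation; census output = EVIDENCE / conjecture items, never a Literature fact; `r = 1`
relation X4-2 = CANDIDATE; labels / RESIDUAL-MAP marks UNCHANGED; nothing booked. Definitions
(predicates / explicit formulas, nothing asserted), one `@[conjecture]` specialisation of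
`CensusX42.RelationAt` to THE census height, and its (definitional) bridge; no named fact.

## What is transcribed (X42-STEP0.md §3 MODEL RULE and §4 PINNED NORMALISATION, sha256 `57430f67…`;
## X42-REPORT.md sha256 `e8592c9a…` §2)

The census's height on the additive curve `E = W` (Cremona reduced minimal model) is
`h(P) = −(2/m²)·log_p(σ_{c_E}(mP)/d(mP))`, `x(mP) = a/d²`, where `σ_c` is the sigma family of `W`
with `log σ_c(z) = log z + (b₂/24 − c/2)z² − …` — i.e. `σ_c` is the odd, normalised solution of the
Mazur–Tate differential equation `x(t) + c = −(d/ω)((1/σ)(dσ/ω))` of `W ⊗ ℚ_p` with constant `c`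
(tree `SatisfiesSigmaODE`; expanding `log σ = log z + Az² + …`, `x = z⁻² − b₂/12 + …` gives
`A = b₂/24 − c/2`, so PARI's/W2's parameter IS the Mazur–Stein–Tate constant) — and
`c_E = U²·s₂(E♭_min) − R`, `U² = (c₆(E)/c₆(E♭))·(c₄(E♭)/c₄(E))`, `R = (U²·b₂(E♭) − b₂(E))/12`
(§3: "the law `c' = (c + r)/u²` for `x = u²x' + r`"; equivalently `c_E − b₂(E)/12 =
U²·(c_{E♭} − b₂(E♭)/12)`, i.e. `E₂(E,ω_E) = U²·E₂(E♭,ω_{E♭})`, `ω_E = U⁻¹ω_{E♭}` over `ℚ(√p*)`),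
with `s₂(E♭_min)` = PARI's `ellpadics2` = the canonical Mazur–Tate constant of the good ordinary (or
multiplicative, via Tate's `E₂(q)`) reduced minimal model of `E♭` (tree: `padicSigmaConst` of
`V ⊗ ℚ_p`, `V` globally minimal good ordinary, `p ≥ 5` — MST 2006 Thm. 1.3, fact
`mazur_tate_sigma_existsUnique`; at a MULTIPLICATIVE `p` the tree's `padicSigmaConst` is NOT the
literature's `E₂(q)/…` constant, so on the (M) rows the transcription below is faithful only once a
Tate-curve `padicSigmaConst` lands — stated scope caveat). At `m = 1` and `c = c_E` the value is the
tree's canonical-height FORMULA `log_p(den x) − 2 log_p σ(−x/y)` (`canonicalPAdicHeight`, Stein–Wuthrich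
2013 (4.1) = `−2p ×` MST's `h_p`; X11b-1's `κ_h = 1` and W2's `h = −2p·H` on 700/700 say PARI's
`ellpadicheight` is exactly this normalisation). Model covariance: `c − b₂/12` and the height value
are invariant under the integral changes `x ↦ x + r` between minimal models (§2 of X42-STEP0: the
own σ-engine returns `H' = H` to 16/16 digits), so ANY globally minimal `W`, `V` may be used.
SCOPE CAVEATS: `j(E) ∈ {0, 1728}` (`c₄c₆ = 0`; W2's "`c_sw = 0` branch") is NOT covered by the
`U²` formula below — the predicate is then about a junk constant and the census rows with
`c₄(E)c₆(E) = 0` are outside this transcription (count to be supplied by W2); existence of a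
BILINEAR datum with this quadratic form (Bernardi quadraticity of `σ_c`-heights at an additive
prime) is not a tree theorem — `RelationAtCensusHeight` quantifies over such data, so it is vacuous,
not false, where none exists (W2: `h(mP) = m²h(P)` componentwise 700/700).

Contents: `transportedSigmaConst W V p` (the constant `c_E`), `sigmaEval`, `sigmaHeight`
(the formula `log_p(den x) − 2 log_p σ(−x/y)` for a given `σ`), `IsTwistSigmaHeight W p V Dh` (THE
census height datum: its quadratic form on admissible points is the sigma height of the odd
normalised solution with constant `c_E`), `@[conjecture] RelationAtCensusHeight W p` (:= X4-2's
`RelationAt W p Dh` for every `Dh` with `IsTwistSigmaHeight W p V Dh`, `V` the GOOD ORDINARY twist,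
`p ≥ 5`, `c₄(E)c₆(E) ≠ 0` — the faithfully transcribed scope; refines `CensusX42.RelationAt`, bridge
`relationAt_of_relationAtCensusHeight` by definition).

References: B. Mazur, W. Stein, J. Tate, Doc. Math. Extra Vol. (2006) Thm. 1.3, §1 eq. (1.1)
[MazurSteinTate2006]; W. Stein, C. Wuthrich, Math. Comp. 82 (2013) §4.1 (4.1) [SteinWuthrich2013];
D. Bernardi, *Hauteur `p`-adique sur les courbes elliptiques*, Sém. Théorie des Nombres Paris
1979–80; The PARI Group, PARI/GP 2.17.2 (`ellpadicheight`, `ellpadics2`); census files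
`X42-STEP0.md` §2–§4, `X42-REPORT.md` §2; `CensusX42LeadingTerm.lean` (X42-m1).
-/

noncomputable section

open scoped Classical

open PowerSeries WeierstrassCurve Literature.NumberTheory.EllipticCurves

namespace Summit.BirchSwinnertonDyer.Rank1Residual.Additive

namespace CensusX42

variable (W : WeierstrassCurve ℚ) (p : ℕ) [Fact p.Prime]

/-- **The transported Mazur–Tate constant** `c_E = U²·(c_{E♭} − b₂(E♭)/12) + b₂(E)/12`,
`U² = (c₆(E)/c₆(E♭))·(c₄(E♭)/c₄(E))`, `c_{E♭}` = the Mazur–Tate constant of the (globally minimal)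
twist `V ⊗ ℚ_p` (tree `padicSigmaConst`) — X42-STEP0 §3 "`c_E = U²·s₂(Fm) − R`,
`R = (U²·b₂(Fm) − b₂(E))/12`". Junk when `c₄(E)c₆(E) = 0` (`j ∈ {0,1728}`).
[cite: MazurSteinTate2006, Thm. 1.3] -/
def transportedSigmaConst (V : WeierstrassCurve ℚ) : ℚ_[p] :=
  (((W.c₆ / V.c₆) * (V.c₄ / W.c₄) : ℚ) : ℚ_[p]) *
      ((V.baseChange ℚ_[p]).padicSigmaConst - ((V.b₂ / 12 : ℚ) : ℚ_[p])) +
    ((W.b₂ / 12 : ℚ) : ℚ_[p])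

/-- Evaluation of a sigma series `σ ∈ ℚ_p⟦t⟧` at `t ∈ ℚ_p` (`tsum`; junk if divergent), as
`padicSigmaEval` does for the canonical `σ_p`. [cite: SteinWuthrich2013, §4.1 eq. (4.1)] -/
def sigmaEval (σ : ℚ_[p]⟦X⟧) (t : ℚ_[p]) : ℚ_[p] :=
  ∑' n : ℕ, PowerSeries.coeff n σ * t ^ n

/-- The **sigma height of a point for a given sigma series** `σ`, Stein–Wuthrich normalisation:
`log_p(den x(P)) − 2 log_p σ(−x/y)` (`= −2 log_p(σ(t(P))/d(P))`, `den x = d²`; PARI's `h` at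
`m = 1`); `0` at `O`; junk off the admissible locus. Twin of `canonicalPAdicHeight` with `σ` a
parameter. [cite: SteinWuthrich2013, §4.1 eq. (4.1)] -/
def sigmaHeight (σ : ℚ_[p]⟦X⟧) : W.toAffine.Point → ℚ_[p]
  | .zero => 0
  | .some x y _ => padicLog p ((x.den : ℚ) : ℚ_[p]) -
      2 * padicLog p (sigmaEval p σ (-(x : ℚ_[p]) / (y : ℚ_[p])))

/-- **THE census height of X4-2 (typed)**: `Dh` is a `p`-adic height datum on `E(ℚ)` whose
quadratic form on every admissible point is the sigma height for the odd normalised solution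
`σ = t + ⋯` of the Mazur–Tate differential equation of `W ⊗ ℚ_p` with the TRANSPORTED constant
`c_E` (`transportedSigmaConst W p V`, `V` the globally minimal semistable twist) — PARI 2.17.2
`ellpadicheight` on the reduced minimal model dotted with the unit-root splitting transported from
`E♭` (X42-STEP0 §3–§4), equivalently `−2p ×` W2's own σ-height. Since `Dh` is bilinear, symmetric and
kills torsion, this pins `Dh` given admissible multiples (as `PAdicHeightData.isCanonical_unique`).
A predicate; nothing asserted. [cite: MazurSteinTate2006, Thm. 1.3] [cite: SteinWuthrich2013, §4.1 eq. (4.1)] -/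
def IsTwistSigmaHeight (V : WeierstrassCurve ℚ) (Dh : PAdicHeightData W p) : Prop :=
  ∃ σ : ℚ_[p]⟦X⟧, PowerSeries.constantCoeff σ = 0 ∧ PowerSeries.coeff 1 σ = 1 ∧
    (W.baseChange ℚ_[p]).IsFormallyOdd σ ∧
    (W.baseChange ℚ_[p]).SatisfiesSigmaODE σ (transportedSigmaConst W p V) ∧
    ∀ P : W.toAffine.Point, W.IsAdmissible p P → Dh.pairing P P = sigmaHeight W p σ P

/-- **Census relation X4-2 for THE census height, on the faithfully transcribed scope** (refines
`CensusX42.RelationAt W p Dh`, whose `Dh` is a parameter): for `p ≥ 5`, `j(E) ∉ {0, 1728}`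
(`c₄(E)c₆(E) ≠ 0`, so the `U²` formula applies), every globally minimal `V` GOOD ORDINARY at `p`
(so `padicSigmaConst (V ⊗ ℚ_p)` is the Mazur–Stein–Tate constant, fact
`mazur_tate_sigma_existsUnique`) and variable change `C` with `C • V^{(±p)} = W`, and every height
datum `Dh` that IS the twist-transported sigma height (`IsTwistSigmaHeight W p V Dh`), the typed
relation `RelationAt W p Dh` holds. This is the (G-ord, `e = 2`), `p ≥ 5` part of the census
universe (the (M) rows and the `p = 3` rows stay covered by the parametric `RelationAt` only, until
a Tate-curve / `p = 3` Mazur–Tate constant is in the tree). EVIDENCE = that of `RelationAt`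
(X42-REPORT.md sha256 `e8592c9a…`; Gord2 train 93/93, held-out 48/48 over all `p`; LEADERBOARD
`813ccc7836d9197d`; CANDIDATE; Gord2 unit-root input single-engine — caveats carried there).
NOT a theorem ⇒ `@[conjecture]`.
[cite: MazurSteinTate2006, Thm. 1.3] [cite: Delbourgo1998, §2.5 BS-D(p)(ii) (shape only; nothing asserted)] -/
@[conjecture]
def RelationAtCensusHeight [W.IsElliptic] [W.IsGloballyMinimal] : Prop :=
  5 ≤ p → W.c₄ ≠ 0 → W.c₆ ≠ 0 →
  ∀ (V : WeierstrassCurve ℚ) [V.IsElliptic] [V.IsGloballyMinimal] (C : VariableChange ℚ),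
    IsOrdinaryAt V p →
    (C • V.quadraticTwist (p : ℚ) = W ∨ C • V.quadraticTwist (-(p : ℚ)) = W) →
    ∀ Dh : PAdicHeightData W p, IsTwistSigmaHeight W p V Dh → RelationAt W p Dh

variable {W p} in
/-- Bridge (definitional): on its scope the census-height relation gives `RelationAt W p Dh` for
the datum `Dh` that is the twist-transported sigma height. [cite: MazurSteinTate2006, Thm. 1.3] -/
theorem relationAt_of_relationAtCensusHeight [W.IsElliptic] [W.IsGloballyMinimal]
    (h : RelationAtCensusHeight W p) (h5 : 5 ≤ p) (h4 : W.c₄ ≠ 0) (h6 : W.c₆ ≠ 0)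
    {V : WeierstrassCurve ℚ} [V.IsElliptic] [V.IsGloballyMinimal] {C : VariableChange ℚ}
    (hord : IsOrdinaryAt V p)
    (hC : C • V.quadraticTwist (p : ℚ) = W ∨ C • V.quadraticTwist (-(p : ℚ)) = W)
    {Dh : PAdicHeightData W p} (hDh : IsTwistSigmaHeight W p V Dh) : RelationAt W p Dh :=
  h h5 h4 h6 V C hord hC Dh hDh

/-- The sigma height vanishes at the origin (bookkeeping). -/
@[simp] theorem sigmaHeight_zero (σ : ℚ_[p]⟦X⟧) : sigmaHeight W p σ 0 = 0 := rfl

end CensusX42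

end Summit.BirchSwinnertonDyer.Rank1Residual.Additive

end
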